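/-
Copyright (c) 2026 the pub-hodgecm-mathlib formalisation cell (harness21).  Prover seat hodgecm-mathlib-K2E4-p11 (g6), Track B ∕ K2-LIT, h413 =
`stmt-HodgeConjecture-24833`, line `K2_E1_TraceFormulaBeta`, campaign «5Res (c) MS-2(χ,τ)» ∕ R8₂ road T′, T1-χ companion (dealer K2E1-plan (g7) deals (141), (150)
2026-09-04): the MODEL prints of ★ `K2E1ChiScatteringBoundMaassSelbergU2` on the GENERAL-BOX `_on'` edition ★ p859884 `K2E1ChiMaassSelbergContinuedOnBoxesCMTwo` (K2E1-p15) — the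
edition the actual pole-exclusion domain `D₁ = (D⁺ ∩ D_n ∩ U) ∖ P` satisfies.
-/
import Summits.HodgeConjecture.HodgeConjecture.Theorems.K2E1ChiScatteringBoundMaassSelbergU2        -- ★ T1-χ (this seat): `sqrt_le_mul_sqrt_of_box`, `norm_le_of_normSq_le`, §5 `…_of_offDual_bound`; brings ★ F2b, ★ T1, ★ (L4)
import Summits.HodgeConjecture.HodgeConjecture.Theorems.K2E1ChiMaassSelbergContinuedOnBoxesCMTwo     -- ★ p859884 (K2E1-p15): `poleControl_continued_chi_cm_two_of_family_on'`, `…_of_truncatedFamily_on'`, `normSq_le_of_family_offDual_on'`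
import HarnessLib

/-!
# R8₂ ROAD T′, T1-χ ON GENERAL BOXES — `K2E1ChiScatteringBoundMaassSelbergOnBoxesU2`: `‖M(z, χ)φ‖ ≤ B·‖φ‖` on the strip (self-dual) and `‖M(z, χ)φ‖ ≤ T^{2Re z−1}‖φ‖` ⟹ NO POLE
# (off-dual), on an open preconnected `D₁ ⊆ D⁺` containing two GENERAL sub-tube boxes — the `_on'` prints consumed on `D₁ = (D⁺ ∩ D_n ∩ U) ∖ P`

Track B ∕ K2-LIT, crux h413 = `stmt-HodgeConjecture-24833`, route of record `HCCMUnconditional`; cell `hodgecm-mathlib`, squad K2, ENGINE E1, campaign «5Res» (c)∕(f); dealer K2E1-plan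
(g7) deals (141) («T1-χ … consumes `normSq_le_of_family_offDual_on'` by name») and (150).  THEOREMS ONLY (no `def`, no `instance`, no notation, no named-fact hypothesis, no `sorry`;
default heartbeats); lane `--kind proof --supports stmt-HodgeConjecture-24833 --as helper` (count-neutral).  Closes no socket.

WHY A SECOND FILE (400-line law; [MoeglinWaldspurger1995, IV.3.12 (a)]).  ★ T1-χ proves the strip bound and the off-dual no-pole corollary from ★ F2∕F2b, whose continuation argument
uses the LITERAL sub-tube boxes `{3 < Re < 4}`, `{1 < Re < 2}` inside `D₁`.  The domain on which the continued objects are actually holomorphic is `D₁ = (D⁺ ∩ D_n ∩ U) ∖ P` (`U` the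
per-ball holomorphy set, `P` the pole set — both with countable complement in the ball), which contains no literal box; ★ p859884 (K2E1-p15) re-ran the argument with two GENERAL open
non-empty boxes `O₁, O₂' ⊆ D₁` separated by `1 < Re z′ < Re z` (picked by density).  This file reads ★ T1-χ's algebra (§1 `sqrt_le_mul_sqrt_of_box`, `norm_le_of_normSq_le`) and its
generic removable-singularity lemmas (§5 `…_of_offDual_bound`) on that edition, and supplies the SELF-DUAL MODEL on general boxes (bracket letters discharged by Hilbert-space calculus
exactly as ★ F2b `poleControl_continued_chi_cm_two_of_family_selfDual_on`).
* §1 **`poleControl_continued_chi_cm_two_of_family_selfDual_on'`** — the self-dual model ((a1)∧(a2)∧(a3), `a = κm‖φ‖²`, `b = κm‖ψ z‖²`) on general boxes (★ p859884 `…_of_family_on'` + ★ F2b §1).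
* §2 SELF-DUAL STRIP BOUND: **`norm_le_of_family_selfDual_on'`** (`‖ψ z‖ ≤ B(σ₀, T)·‖φ‖` on `D₁ ∩ {Re ≤ σ₀, |Im| ≥ 1}`), `exists_norm_le_of_family_selfDual_on'`,
  `sqrt_bracket_le_of_truncatedFamily_on'` (★ p859884's `L²(X)` truncated-family currency).
* §3 OFF-DUAL BOUND: **`norm_le_of_family_offDual_on'`** (`‖ψ z‖ ≤ T^{2Re z−1}‖φ‖` on all of `D₁`, ★ `normSq_le_of_family_offDual_on'` BY NAME), `normSq_le_rpow_mul_normSq_of_family_offDual_on'`.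
* §4 OFF-DUAL ⟹ NO POLE at every `z₁` surrounded by `D₁` (`∀ᶠ z in 𝓝[≠] z₁, z ∈ D₁` — every `z₁ ∈ D⁺ ∩ D_n` for `D₁ = (D⁺ ∩ D_n ∩ U) ∖ P`):
  **`meromorphicOrderAt_nonneg_of_family_offDual_on'`**, **`exists_analyticAt_extension_of_family_offDual_on'`**, **`analyticAt_of_family_offDual_on'`** (normal form).
HONEST LABEL: HC_CM is proved only modulo the 7 printed citations (2 remaining named inputs: hLiu418 = `stmt-HodgeConjecture-24832`, h413 = `stmt-HodgeConjecture-24833`) until rung 0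
closes; this file asserts no named fact, is conditional by construction on the relation letter `hrel` ∕ `h4`, and closes no socket; count-neutral.

## References
* [MoeglinWaldspurger1995] C. Mœglin, J.-L. Waldspurger, *Spectral decomposition and Eisenstein series* (1995), IV.1.9, IV.1.11, IV.2.3, IV.3.12 (a).
* [Langlands1976] R. P. Langlands, *On the Functional Equations Satisfied by Eisenstein Series*, LNM 544 (1976), §7.
* [Arthur1980TraceFormulaII] J. Arthur, *A trace formula for reductive groups II*, Compositio Math. 40 (1980), §4.
* [BernsteinLapid2019] J. Bernstein, E. Lapid, *On the meromorphic continuation of Eisenstein series*, J. AMS 37 (2024), §4 p. 10.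
-/

set_option autoImplicit false
set_option linter.dupNamespace false  -- the mandated namespace repeats the summit's segment (`HodgeConjecture.HodgeConjecture`)

noncomputable section

open Real Set Filter Topology MeasureTheory Measure NumberField IsDedekindDomain
open scoped ENNReal NNReal ComplexConjugate InnerProductSpace
open Literature.NumberTheory.Automorphic Literature.NumberTheory.Automorphic.UnitaryGroup AdelicGroupData
open Summit.HodgeConjecture.HodgeConjecture.Cruxes.H413.K2E1BorelEisensteinU
open Summit.HodgeConjecture.HodgeConjecture.Cruxes.H413.K2E1ChiMaassSelbergContinuedModelsCMTwo (real_mul_inner_self differentiableOn_inner_conj_comp norm_sq_real_mul_inner_le)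
open Summit.HodgeConjecture.HodgeConjecture.Cruxes.H413.K2E1ChiMaassSelbergContinuedOnBoxesCMTwo (poleControl_continued_chi_cm_two_of_family_on'
  poleControl_continued_chi_cm_two_of_truncatedFamily_on' normSq_le_of_family_offDual_on')
open Summit.HodgeConjecture.HodgeConjecture.Cruxes.H413.K2E1ChiScatteringBoundMaassSelbergU2 (sqrt_le_mul_sqrt_of_box norm_le_of_normSq_le
  analyticAt_of_offDual_bound exists_analyticAt_extension_of_offDual_bound meromorphicOrderAt_nonneg_of_offDual_bound)

namespace Summit.HodgeConjecture.HodgeConjecture.Cruxes.H413.K2E1ChiScatteringBoundMaassSelbergOnBoxesU2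

/-! ## §1 The self-dual model on general boxes -/

section SelfDual

variable {V : Type*} [NormedAddCommGroup V] [InnerProductSpace ℂ V] {H : Type*} [NormedAddCommGroup H] [InnerProductSpace ℂ H]

/-- **SELF-DUAL MODEL (`χ = χʷ`) ON GENERAL BOXES: every bracket letter discharged.**  One complex inner-product space `V`, `φ ∈ V ∖ 0`, `ψ : ℂ → V` holomorphic on `D₁` (the continued
`z ↦ M(z, χ)φ`), `κ, m > 0`; `D₁ ⊆ D⁺` open preconnected ⊇ two open non-empty `O₁, O₂'` with `1 < Re z′ < Re z` on `O₁ × O₂'`; `F : ℂ → H` holomorphic on `D₁` with the four-bracket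
relation on the sub-tube for `κm⟪φ, φ⟫`, `κm⟪ψ z′, φ⟫`, `κm⟪φ, ψ z⟫`, `κm⟪ψ z′, ψ z⟫`.  THEN (a1)∧(a2)∧(a3) with `a = κm‖φ‖²`, `b(z) = κm‖ψ z‖²` at every `z ∈ D₁` — ★ p859884
`poleControl_continued_chi_cm_two_of_family_on'` with its letters paid as in ★ F2b (`innerSL`, ★ `differentiableOn_inner_conj_comp`, ★ `real_mul_inner_self`, ★ `norm_sq_real_mul_inner_le`).
[cite: MoeglinWaldspurger1995, IV.2.3, IV.3.12 (a)] [cite: Arthur1980TraceFormulaII, §4] -/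
theorem poleControl_continued_chi_cm_two_of_family_selfDual_on' {D₁ : Set ℂ} (hD₁ : IsOpen D₁) (hD₁c : IsPreconnected D₁) (hD₁sub : D₁ ⊆ {z : ℂ | 1 / 2 < z.re ∧ 0 < z.im})
    {O₁ O₂' : Set ℂ} (hO₁ : IsOpen O₁) (hO₁ne : O₁.Nonempty) (hO₁D : O₁ ⊆ D₁) (hO₂' : IsOpen O₂') (hO₂'ne : O₂'.Nonempty) (hO₂'D : O₂' ⊆ D₁)
    (hsep : ∀ z ∈ O₁, ∀ z' ∈ O₂', 1 < z'.re ∧ z'.re < z.re)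
    {T cμ K κ m : ℝ} (hT : 1 ≤ T) (hcμ : 0 < cμ) (hK : 0 < K) (hκ : 0 < κ) (hm : 0 < m) {φ : V} (hφ : φ ≠ 0) {ψ : ℂ → V} (hψ : DifferentiableOn ℂ ψ D₁)
    (F : ℂ → H) (hFd : DifferentiableOn ℂ F D₁)
    (hrel : ∀ z ∈ D₁, ∀ z' ∈ D₁, 1 < z'.re → z'.re < z.re →
      ⟪F z', F z⟫_ℂ = ((cμ : ℝ) : ℂ) * (((K : ℝ) : ℂ) *
        ((((T : ℝ) : ℂ) ^ (z + conj z' - 1) / (z + conj z' - 1)) * (((κ : ℝ) : ℂ) * (((m : ℝ) : ℂ) * ⟪φ, φ⟫_ℂ))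
          + (((T : ℝ) : ℂ) ^ (z - conj z') / (z - conj z')) * (((κ : ℝ) : ℂ) * (((m : ℝ) : ℂ) * ⟪ψ z', φ⟫_ℂ))
          - (((T : ℝ) : ℂ) ^ (-(z - conj z')) / (z - conj z')) * (((κ : ℝ) : ℂ) * (((m : ℝ) : ℂ) * ⟪φ, ψ z⟫_ℂ))
          - (((T : ℝ) : ℂ) ^ (-(z + conj z' - 1)) / (z + conj z' - 1)) * (((κ : ℝ) : ℂ) * (((m : ℝ) : ℂ) * ⟪ψ z', ψ z⟫_ℂ)))))
    {z : ℂ} (hz : z ∈ D₁) :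
    Real.sqrt (κ * m * ‖ψ z‖ ^ 2) ≤ (z.re - 1 / 2) * T ^ (2 * (z.re - 1 / 2)) * Real.sqrt (κ * m * ‖φ‖ ^ 2) / |z.im| +
        Real.sqrt ((z.re - 1 / 2) ^ 2 * T ^ (4 * (z.re - 1 / 2)) * (κ * m * ‖φ‖ ^ 2) / z.im ^ 2 + (κ * m * ‖φ‖ ^ 2) * T ^ (4 * (z.re - 1 / 2))) ∧
      (∀ {x₁ x₂ η : ℝ}, 0 < x₁ → (z.re - 1 / 2) ∈ Set.Icc x₁ x₂ → 0 < η → η ≤ |z.im| →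
        κ * m * ‖ψ z‖ ^ 2 ≤ (x₂ * T ^ (2 * x₂) * Real.sqrt (κ * m * ‖φ‖ ^ 2) / η + Real.sqrt (x₂ ^ 2 * T ^ (4 * x₂) * (κ * m * ‖φ‖ ^ 2) / η ^ 2 + (κ * m * ‖φ‖ ^ 2) * T ^ (4 * x₂))) ^ 2) ∧
      (|z.im| ≤ 1 → κ * m * ‖ψ z‖ ^ 2 ≤ ((z.re - 1 / 2) * T ^ (2 * (z.re - 1 / 2)) * Real.sqrt (κ * m * ‖φ‖ ^ 2) +
        Real.sqrt ((z.re - 1 / 2) ^ 2 * T ^ (4 * (z.re - 1 / 2)) * (κ * m * ‖φ‖ ^ 2) + (κ * m * ‖φ‖ ^ 2) * T ^ (4 * (z.re - 1 / 2)))) ^ 2 / z.im ^ 2) := by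
  have hφn : 0 < ‖φ‖ := norm_pos_iff.2 hφ
  have ha : 0 < κ * m * ‖φ‖ ^ 2 := by positivity
  have hB₂ : DifferentiableOn ℂ (fun w : ℂ => ((κ : ℝ) : ℂ) * (((m : ℝ) : ℂ) * ⟪ψ (conj w), φ⟫_ℂ)) {w : ℂ | conj w ∈ D₁} :=
    ((differentiableOn_inner_conj_comp hD₁ hψ φ).const_mul _).const_mul _
  have hB₃ : DifferentiableOn ℂ (fun z : ℂ => ((κ : ℝ) : ℂ) * (((m : ℝ) : ℂ) * ⟪φ, ψ z⟫_ℂ)) D₁ :=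
    (((innerSL ℂ φ).differentiable.comp_differentiableOn hψ).const_mul _).const_mul _
  have hB₃₂ : ∀ z ∈ D₁, ((κ : ℝ) : ℂ) * (((m : ℝ) : ℂ) * ⟪φ, ψ z⟫_ℂ) = conj (((κ : ℝ) : ℂ) * (((m : ℝ) : ℂ) * ⟪ψ z, φ⟫_ℂ)) := fun z _ => by
    rw [map_mul, map_mul, Complex.conj_ofReal, Complex.conj_ofReal, inner_conj_symm]
  have hB₄₁ : ∀ z' ∈ D₁, DifferentiableOn ℂ (fun z : ℂ => ((κ : ℝ) : ℂ) * (((m : ℝ) : ℂ) * ⟪ψ z', ψ z⟫_ℂ)) D₁ := fun z' _ =>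
    (((innerSL ℂ (ψ z')).differentiable.comp_differentiableOn hψ).const_mul _).const_mul _
  have hB₄₂ : ∀ z ∈ D₁, DifferentiableOn ℂ (fun w : ℂ => ((κ : ℝ) : ℂ) * (((m : ℝ) : ℂ) * ⟪ψ (conj w), ψ z⟫_ℂ)) {w : ℂ | conj w ∈ D₁} := fun z _ =>
    ((differentiableOn_inner_conj_comp hD₁ hψ (ψ z)).const_mul _).const_mul _
  exact poleControl_continued_chi_cm_two_of_family_on' hD₁ hD₁c hD₁sub hO₁ hO₁ne hO₁D hO₂' hO₂'ne hO₂'D hsep hT hcμ hK ha (b := fun z => κ * m * ‖ψ z‖ ^ 2) (fun z _ => by positivity)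
    (B₁ := ((κ : ℝ) : ℂ) * (((m : ℝ) : ℂ) * ⟪φ, φ⟫_ℂ)) (B₂ := fun z' => ((κ : ℝ) : ℂ) * (((m : ℝ) : ℂ) * ⟪ψ z', φ⟫_ℂ))
    (B₃ := fun z => ((κ : ℝ) : ℂ) * (((m : ℝ) : ℂ) * ⟪φ, ψ z⟫_ℂ)) (B₄ := fun z z' => ((κ : ℝ) : ℂ) * (((m : ℝ) : ℂ) * ⟪ψ z', ψ z⟫_ℂ))
    (real_mul_inner_self κ m φ) hB₂ hB₃ hB₃₂ hB₄₁ hB₄₂ (fun z _ => real_mul_inner_self κ m (ψ z)) (fun z _ => norm_sq_real_mul_inner_le hκ.le hm.le (ψ z) φ) F hFd hrel hz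

/-! ## §2 SELF-DUAL: the strip bound `‖M(z, χ)φ‖ ≤ B(σ₀, T)·‖φ‖` on general boxes -/

/-- **T1-χ, SELF-DUAL MODEL ON GENERAL BOXES: `‖M(z, χ)φ‖ ≤ B(σ₀, T)·‖φ‖` ON `D₁ ∩ {Re z ≤ σ₀, |Im z| ≥ 1}`** (§1 (a2) read through ★ `sqrt_le_mul_sqrt_of_box`;
`B(σ₀, T) = (σ₀ − ½)T^{2(σ₀−½)} + √((σ₀ − ½)²T^{4(σ₀−½)} + T^{4(σ₀−½)})` free of `φ` and of `Im z`). [cite: MoeglinWaldspurger1995, IV.2.3, IV.3.12 (a)] [cite: Langlands1976, §7] -/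
theorem norm_le_of_family_selfDual_on' {D₁ : Set ℂ} (hD₁ : IsOpen D₁) (hD₁c : IsPreconnected D₁) (hD₁sub : D₁ ⊆ {z : ℂ | 1 / 2 < z.re ∧ 0 < z.im})
    {O₁ O₂' : Set ℂ} (hO₁ : IsOpen O₁) (hO₁ne : O₁.Nonempty) (hO₁D : O₁ ⊆ D₁) (hO₂' : IsOpen O₂') (hO₂'ne : O₂'.Nonempty) (hO₂'D : O₂' ⊆ D₁)
    (hsep : ∀ z ∈ O₁, ∀ z' ∈ O₂', 1 < z'.re ∧ z'.re < z.re)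
    {T cμ K κ m : ℝ} (hT : 1 ≤ T) (hcμ : 0 < cμ) (hK : 0 < K) (hκ : 0 < κ) (hm : 0 < m) {φ : V} (hφ : φ ≠ 0) {ψ : ℂ → V} (hψ : DifferentiableOn ℂ ψ D₁)
    (F : ℂ → H) (hFd : DifferentiableOn ℂ F D₁)
    (hrel : ∀ z ∈ D₁, ∀ z' ∈ D₁, 1 < z'.re → z'.re < z.re →
      ⟪F z', F z⟫_ℂ = ((cμ : ℝ) : ℂ) * (((K : ℝ) : ℂ) *
        ((((T : ℝ) : ℂ) ^ (z + conj z' - 1) / (z + conj z' - 1)) * (((κ : ℝ) : ℂ) * (((m : ℝ) : ℂ) * ⟪φ, φ⟫_ℂ))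
          + (((T : ℝ) : ℂ) ^ (z - conj z') / (z - conj z')) * (((κ : ℝ) : ℂ) * (((m : ℝ) : ℂ) * ⟪ψ z', φ⟫_ℂ))
          - (((T : ℝ) : ℂ) ^ (-(z - conj z')) / (z - conj z')) * (((κ : ℝ) : ℂ) * (((m : ℝ) : ℂ) * ⟪φ, ψ z⟫_ℂ))
          - (((T : ℝ) : ℂ) ^ (-(z + conj z' - 1)) / (z + conj z' - 1)) * (((κ : ℝ) : ℂ) * (((m : ℝ) : ℂ) * ⟪ψ z', ψ z⟫_ℂ)))))
    (σ₀ : ℝ) {z : ℂ} (hz : z ∈ D₁) (hz₂ : z.re ≤ σ₀) (ht : 1 ≤ |z.im|) :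
    ‖ψ z‖ ≤ ((σ₀ - 1 / 2) * T ^ (2 * (σ₀ - 1 / 2)) + Real.sqrt ((σ₀ - 1 / 2) ^ 2 * T ^ (4 * (σ₀ - 1 / 2)) + T ^ (4 * (σ₀ - 1 / 2)))) * ‖φ‖ := by
  obtain ⟨-, h2, -⟩ := poleControl_continued_chi_cm_two_of_family_selfDual_on' hD₁ hD₁c hD₁sub hO₁ hO₁ne hO₁D hO₂' hO₂'ne hO₂'D hsep hT hcμ hK hκ hm hφ hψ F hFd hrel hz
  have hz₁ : 1 / 2 < z.re := (hD₁sub hz).1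
  have hT0 : 0 < T := lt_of_lt_of_le one_pos hT
  have hx₂ : 0 ≤ σ₀ - 1 / 2 := by linarith
  have hkm : 0 < κ * m := mul_pos hκ hm
  have h := @h2 (z.re - 1 / 2) (σ₀ - 1 / 2) 1 (by linarith) ⟨le_rfl, by linarith⟩ one_pos ht
  have h3 := sqrt_le_mul_sqrt_of_box (a := κ * m * ‖φ‖ ^ 2) hx₂ one_pos hT0 h
  simp only [div_one, one_pow] at h3
  have e1 : Real.sqrt (κ * m * ‖ψ z‖ ^ 2) = Real.sqrt (κ * m) * ‖ψ z‖ := by rw [Real.sqrt_mul hkm.le, Real.sqrt_sq (norm_nonneg _)]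
  have e2 : Real.sqrt (κ * m * ‖φ‖ ^ 2) = Real.sqrt (κ * m) * ‖φ‖ := by rw [Real.sqrt_mul hkm.le, Real.sqrt_sq (norm_nonneg _)]
  rw [e1, e2] at h3
  have h4 : Real.sqrt (κ * m) * ‖ψ z‖ ≤ Real.sqrt (κ * m) *
      (((σ₀ - 1 / 2) * T ^ (2 * (σ₀ - 1 / 2)) + Real.sqrt ((σ₀ - 1 / 2) ^ 2 * T ^ (4 * (σ₀ - 1 / 2)) + T ^ (4 * (σ₀ - 1 / 2)))) * ‖φ‖) := by
    calc Real.sqrt (κ * m) * ‖ψ z‖ ≤ _ := h3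
      _ = _ := by ring
  exact le_of_mul_le_mul_left h4 (Real.sqrt_pos.2 hkm)

/-- **T1-χ, SELF-DUAL MODEL ON GENERAL BOXES, `∃ B` FORM**: `∃ B ≥ 0, ∀ z ∈ D₁, Re z ≤ σ₀ → |Im z| ≥ 1 → ‖ψ z‖ ≤ B·‖φ‖`. [cite: MoeglinWaldspurger1995, IV.3.12 (a)]
[cite: Langlands1976, §7] -/
theorem exists_norm_le_of_family_selfDual_on' {D₁ : Set ℂ} (hD₁ : IsOpen D₁) (hD₁c : IsPreconnected D₁) (hD₁sub : D₁ ⊆ {z : ℂ | 1 / 2 < z.re ∧ 0 < z.im})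
    {O₁ O₂' : Set ℂ} (hO₁ : IsOpen O₁) (hO₁ne : O₁.Nonempty) (hO₁D : O₁ ⊆ D₁) (hO₂' : IsOpen O₂') (hO₂'ne : O₂'.Nonempty) (hO₂'D : O₂' ⊆ D₁)
    (hsep : ∀ z ∈ O₁, ∀ z' ∈ O₂', 1 < z'.re ∧ z'.re < z.re)
    {T cμ K κ m : ℝ} (hT : 1 ≤ T) (hcμ : 0 < cμ) (hK : 0 < K) (hκ : 0 < κ) (hm : 0 < m) {φ : V} (hφ : φ ≠ 0) {ψ : ℂ → V} (hψ : DifferentiableOn ℂ ψ D₁)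
    (F : ℂ → H) (hFd : DifferentiableOn ℂ F D₁)
    (hrel : ∀ z ∈ D₁, ∀ z' ∈ D₁, 1 < z'.re → z'.re < z.re →
      ⟪F z', F z⟫_ℂ = ((cμ : ℝ) : ℂ) * (((K : ℝ) : ℂ) *
        ((((T : ℝ) : ℂ) ^ (z + conj z' - 1) / (z + conj z' - 1)) * (((κ : ℝ) : ℂ) * (((m : ℝ) : ℂ) * ⟪φ, φ⟫_ℂ))
          + (((T : ℝ) : ℂ) ^ (z - conj z') / (z - conj z')) * (((κ : ℝ) : ℂ) * (((m : ℝ) : ℂ) * ⟪ψ z', φ⟫_ℂ))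
          - (((T : ℝ) : ℂ) ^ (-(z - conj z')) / (z - conj z')) * (((κ : ℝ) : ℂ) * (((m : ℝ) : ℂ) * ⟪φ, ψ z⟫_ℂ))
          - (((T : ℝ) : ℂ) ^ (-(z + conj z' - 1)) / (z + conj z' - 1)) * (((κ : ℝ) : ℂ) * (((m : ℝ) : ℂ) * ⟪ψ z', ψ z⟫_ℂ)))))
    (σ₀ : ℝ) :
    ∃ B : ℝ, 0 ≤ B ∧ ∀ z ∈ D₁, z.re ≤ σ₀ → 1 ≤ |z.im| → ‖ψ z‖ ≤ B * ‖φ‖ := by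
  refine ⟨|(σ₀ - 1 / 2) * T ^ (2 * (σ₀ - 1 / 2)) + Real.sqrt ((σ₀ - 1 / 2) ^ 2 * T ^ (4 * (σ₀ - 1 / 2)) + T ^ (4 * (σ₀ - 1 / 2)))|, abs_nonneg _,
    fun z hz hz₂ ht => (norm_le_of_family_selfDual_on' hD₁ hD₁c hD₁sub hO₁ hO₁ne hO₁D hO₂' hO₂'ne hO₂'D hsep hT hcμ hK hκ hm hφ hψ F hFd hrel σ₀ hz hz₂ ht).trans ?_⟩
  exact mul_le_mul_of_nonneg_right (le_abs_self _) (norm_nonneg _)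

end SelfDual

section TruncatedFamily

variable (L : Type) [Field L] [NumberField L] [IsCMField L]
variable [MeasurableSpace (quasiSplit (↥(maximalRealSubfield L)) L (IsCMField.complexConj L) 2).Adelic]

/-- **T1-χ IN THE `L²(X, μ)` TRUNCATED-FAMILY CURRENCY ON GENERAL BOXES** (the letters of ★ p859884 `poleControl_continued_chi_cm_two_of_truncatedFamily_on'` VERBATIM): on
`D₁ ∩ {Re z ≤ σ₀, |Im z| ≥ 1}`, `√b(z) ≤ B(σ₀, T)·√a`. [cite: MoeglinWaldspurger1995, IV.2.3, IV.3.12 (a)] [cite: Arthur1980TraceFormulaII, §4] [cite: Langlands1976, §7] -/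
theorem sqrt_bracket_le_of_truncatedFamily_on' {D₁ : Set ℂ} (hD₁ : IsOpen D₁) (hD₁c : IsPreconnected D₁) (hD₁sub : D₁ ⊆ {z : ℂ | 1 / 2 < z.re ∧ 0 < z.im})
    {O₁ O₂' : Set ℂ} (hO₁ : IsOpen O₁) (hO₁ne : O₁.Nonempty) (hO₁D : O₁ ⊆ D₁) (hO₂' : IsOpen O₂') (hO₂'ne : O₂'.Nonempty) (hO₂'D : O₂' ⊆ D₁)
    (hsep : ∀ z ∈ O₁, ∀ z' ∈ O₂', 1 < z'.re ∧ z'.re < z.re)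
    (μ : Measure (quasiSplit (↥(maximalRealSubfield L)) L (IsCMField.complexConj L) 2).automorphicQuotient)
    (ν : Measure ↥(adelicUnipotent (↥(maximalRealSubfield L)) L (IsCMField.complexConj L) 2)) (𝓕 : Set ↥(adelicUnipotent (↥(maximalRealSubfield L)) L (IsCMField.complexConj L) 2))
    {T : ℝ≥0} (hT : 1 ≤ T) {cμ K : ℝ} (hcμ : 0 < cμ) (hK : 0 < K) {a : ℝ} (ha : 0 < a) {b : ℂ → ℝ} (hb : ∀ z ∈ D₁, 0 ≤ b z)
    {B₁ : ℂ} {B₂ B₃ : ℂ → ℂ} {B₄ : ℂ → ℂ → ℂ} (hB₁ : B₁ = ((a : ℝ) : ℂ)) (hB₂ : DifferentiableOn ℂ (fun w : ℂ => B₂ (conj w)) {w : ℂ | conj w ∈ D₁}) (hB₃ : DifferentiableOn ℂ B₃ D₁)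
    (hB₃₂ : ∀ z ∈ D₁, B₃ z = conj (B₂ z)) (hB₄₁ : ∀ z' ∈ D₁, DifferentiableOn ℂ (fun z : ℂ => B₄ z z') D₁)
    (hB₄₂ : ∀ z ∈ D₁, DifferentiableOn ℂ (fun w : ℂ => B₄ z (conj w)) {w : ℂ | conj w ∈ D₁}) (hB₄d : ∀ z ∈ D₁, B₄ z z = ((b z : ℝ) : ℂ))
    (hCS : ∀ z ∈ D₁, ‖B₂ z‖ ^ 2 ≤ a * b z)
    (φ : (quasiSplit (↥(maximalRealSubfield L)) L (IsCMField.complexConj L) 2).Adelic → ℂ)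
    (F : ℂ → Lp ℂ 2 μ) (hFd : DifferentiableOn ℂ F D₁)
    (hFtube : ∀ z ∈ D₁, 1 < z.re → ((F z : Lp ℂ 2 μ) : (quasiSplit (↥(maximalRealSubfield L)) L (IsCMField.complexConj L) 2).automorphicQuotient → ℂ) =ᵐ[μ] (quasiSplit (↥(maximalRealSubfield L)) L (IsCMField.complexConj L) 2).quotFun (truncation ν 𝓕 T (eisensteinSeriesU (flatSectionU φ z))))
    (h4 : ∀ z z' : ℂ, 1 < z'.re → z'.re < z.re →
      ∫ x, (quasiSplit (↥(maximalRealSubfield L)) L (IsCMField.complexConj L) 2).quotFun (truncation ν 𝓕 T (eisensteinSeriesU (flatSectionU φ z))) x * conj ((quasiSplit (↥(maximalRealSubfield L)) L (IsCMField.complexConj L) 2).quotFun (truncation ν 𝓕 T (eisensteinSeriesU (flatSectionU φ z'))) x) ∂μ =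
      ((cμ : ℝ) : ℂ) * (((K : ℝ) : ℂ) *
        ((((T : ℝ) : ℂ) ^ (z + conj z' - 1) / (z + conj z' - 1)) * B₁
          + (((T : ℝ) : ℂ) ^ (z - conj z') / (z - conj z')) * B₂ z'
          - (((T : ℝ) : ℂ) ^ (-(z - conj z')) / (z - conj z')) * B₃ z
          - (((T : ℝ) : ℂ) ^ (-(z + conj z' - 1)) / (z + conj z' - 1)) * B₄ z z')))
    (σ₀ : ℝ) {z : ℂ} (hz : z ∈ D₁) (hz₂ : z.re ≤ σ₀) (ht : 1 ≤ |z.im|) :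
    Real.sqrt (b z) ≤ ((σ₀ - 1 / 2) * (T : ℝ) ^ (2 * (σ₀ - 1 / 2)) + Real.sqrt ((σ₀ - 1 / 2) ^ 2 * (T : ℝ) ^ (4 * (σ₀ - 1 / 2)) + (T : ℝ) ^ (4 * (σ₀ - 1 / 2)))) * Real.sqrt a := by
  obtain ⟨-, h2, -⟩ := poleControl_continued_chi_cm_two_of_truncatedFamily_on' L hD₁ hD₁c hD₁sub hO₁ hO₁ne hO₁D hO₂' hO₂'ne hO₂'D hsep μ ν 𝓕 hT hcμ hK ha hb hB₁ hB₂ hB₃ hB₃₂ hB₄₁ hB₄₂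
    hB₄d hCS φ F hFd hFtube h4 hz
  have hz₁ : 1 / 2 < z.re := (hD₁sub hz).1
  have hT0 : 0 < (T : ℝ) := lt_of_lt_of_le one_pos (by exact_mod_cast hT)
  have hx₂ : 0 ≤ σ₀ - 1 / 2 := by linarith
  have h := @h2 (z.re - 1 / 2) (σ₀ - 1 / 2) 1 (by linarith) ⟨le_rfl, by linarith⟩ one_pos ht
  have h3 := sqrt_le_mul_sqrt_of_box hx₂ one_pos hT0 h
  simpa only [div_one, one_pow] using h3

end TruncatedFamily

/-! ## §3 OFF-DUAL: the `y`-free bound on general boxes (★ `normSq_le_of_family_offDual_on'` BY NAME) -/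

section OffDual

variable {V : Type*} [NormedAddCommGroup V] [InnerProductSpace ℂ V] {V' : Type*} [NormedAddCommGroup V'] [InnerProductSpace ℂ V']
  {H : Type*} [NormedAddCommGroup H] [InnerProductSpace ℂ H]

/-- **T1-χ, OFF-DUAL MODEL ON GENERAL BOXES: `‖M(z, χ)φ‖ ≤ T^{2Re z − 1}·‖φ‖` AT EVERY `z ∈ D₁`** (★ p859884 `normSq_le_of_family_offDual_on'` unsquared; its letters VERBATIM plus
`κ, m > 0`). [cite: MoeglinWaldspurger1995, IV.1.11, IV.3.12 (a)] [cite: Arthur1980TraceFormulaII, §4] -/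
theorem norm_le_of_family_offDual_on' {D₁ : Set ℂ} (hD₁ : IsOpen D₁) (hD₁c : IsPreconnected D₁) (hD₁sub : D₁ ⊆ {z : ℂ | 1 / 2 < z.re ∧ 0 < z.im})
    {O₁ O₂' : Set ℂ} (hO₁ : IsOpen O₁) (hO₁ne : O₁.Nonempty) (hO₁D : O₁ ⊆ D₁) (hO₂' : IsOpen O₂') (hO₂'ne : O₂'.Nonempty) (hO₂'D : O₂' ⊆ D₁)
    (hsep : ∀ z ∈ O₁, ∀ z' ∈ O₂', 1 < z'.re ∧ z'.re < z.re)
    {T cμ K κ m : ℝ} (hT : 1 ≤ T) (hcμ : 0 < cμ) (hK : 0 < K) (hκ : 0 < κ) (hm : 0 < m) (φ : V) {ψ : ℂ → V'} (hψ : DifferentiableOn ℂ ψ D₁)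
    (F : ℂ → H) (hFd : DifferentiableOn ℂ F D₁)
    (hrel : ∀ z ∈ D₁, ∀ z' ∈ D₁, 1 < z'.re → z'.re < z.re →
      ⟪F z', F z⟫_ℂ = ((cμ : ℝ) : ℂ) * (((K : ℝ) : ℂ) *
        ((((T : ℝ) : ℂ) ^ (z + conj z' - 1) / (z + conj z' - 1)) * (((κ : ℝ) : ℂ) * (((m : ℝ) : ℂ) * ⟪φ, φ⟫_ℂ))
          - (((T : ℝ) : ℂ) ^ (-(z + conj z' - 1)) / (z + conj z' - 1)) * (((κ : ℝ) : ℂ) * (((m : ℝ) : ℂ) * ⟪ψ z', ψ z⟫_ℂ)))))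
    {z : ℂ} (hz : z ∈ D₁) :
    ‖ψ z‖ ≤ T ^ (2 * z.re - 1) * ‖φ‖ := by
  have h := normSq_le_of_family_offDual_on' hD₁ hD₁c hD₁sub hO₁ hO₁ne hO₁D hO₂' hO₂'ne hO₂'D hsep hT hcμ hK κ m φ hψ F hFd hrel hz
  have h2 := norm_le_of_normSq_le hκ hm (lt_of_lt_of_le one_pos hT) h
  have e : 2 * (z.re - 1 / 2) = 2 * z.re - 1 := by ring
  rwa [e] at h2

/-- **OFF-DUAL ON GENERAL BOXES, SQUARED FORM**: `‖M(z, χ)φ‖² ≤ T^{4Re z − 2}·‖φ‖²` at every `z ∈ D₁`. [cite: MoeglinWaldspurger1995, IV.1.11, IV.3.12 (a)] -/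
theorem normSq_le_rpow_mul_normSq_of_family_offDual_on' {D₁ : Set ℂ} (hD₁ : IsOpen D₁) (hD₁c : IsPreconnected D₁) (hD₁sub : D₁ ⊆ {z : ℂ | 1 / 2 < z.re ∧ 0 < z.im})
    {O₁ O₂' : Set ℂ} (hO₁ : IsOpen O₁) (hO₁ne : O₁.Nonempty) (hO₁D : O₁ ⊆ D₁) (hO₂' : IsOpen O₂') (hO₂'ne : O₂'.Nonempty) (hO₂'D : O₂' ⊆ D₁)
    (hsep : ∀ z ∈ O₁, ∀ z' ∈ O₂', 1 < z'.re ∧ z'.re < z.re)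
    {T cμ K κ m : ℝ} (hT : 1 ≤ T) (hcμ : 0 < cμ) (hK : 0 < K) (hκ : 0 < κ) (hm : 0 < m) (φ : V) {ψ : ℂ → V'} (hψ : DifferentiableOn ℂ ψ D₁)
    (F : ℂ → H) (hFd : DifferentiableOn ℂ F D₁)
    (hrel : ∀ z ∈ D₁, ∀ z' ∈ D₁, 1 < z'.re → z'.re < z.re →
      ⟪F z', F z⟫_ℂ = ((cμ : ℝ) : ℂ) * (((K : ℝ) : ℂ) *
        ((((T : ℝ) : ℂ) ^ (z + conj z' - 1) / (z + conj z' - 1)) * (((κ : ℝ) : ℂ) * (((m : ℝ) : ℂ) * ⟪φ, φ⟫_ℂ))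
          - (((T : ℝ) : ℂ) ^ (-(z + conj z' - 1)) / (z + conj z' - 1)) * (((κ : ℝ) : ℂ) * (((m : ℝ) : ℂ) * ⟪ψ z', ψ z⟫_ℂ)))))
    {z : ℂ} (hz : z ∈ D₁) :
    ‖ψ z‖ ^ 2 ≤ T ^ (4 * z.re - 2) * ‖φ‖ ^ 2 := by
  have hT0 : 0 < T := lt_of_lt_of_le one_pos hT
  have h := norm_le_of_family_offDual_on' hD₁ hD₁c hD₁sub hO₁ hO₁ne hO₁D hO₂' hO₂'ne hO₂'D hsep hT hcμ hK hκ hm φ hψ F hFd hrel hz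
  have h4 : T ^ (4 * z.re - 2) = T ^ (2 * z.re - 1) * T ^ (2 * z.re - 1) := by rw [← Real.rpow_add hT0]; congr 1; ring
  calc ‖ψ z‖ ^ 2 ≤ (T ^ (2 * z.re - 1) * ‖φ‖) ^ 2 := pow_le_pow_left₀ (norm_nonneg _) h 2
    _ = T ^ (4 * z.re - 2) * ‖φ‖ ^ 2 := by rw [h4]; ring

/-! ## §4 OFF-DUAL ⟹ NO POLE at every point surrounded by `D₁` -/

/-- **THE OFF-DUAL CONTINUED FAMILY HAS NO POLE IN `{½ < Re z}` — MODEL FORM ON GENERAL BOXES.**  ★ p859884's off-dual letters on `D₁`, `κ, m > 0`, and a point `z₁` SURROUNDED by `D₁`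
(`∀ᶠ z in 𝓝[≠] z₁, z ∈ D₁` — every point of `D⁺ ∩ D_n` when `D₁ = (D⁺ ∩ D_n ∩ U) ∖ P` with `(D_n ∖ U) ∪ P` discrete in the ball, INCLUDING the excluded points): `ψ` is `MeromorphicAt z₁`
with NON-NEGATIVE order (§3 bound + ★ `meromorphicOrderAt_nonneg_of_offDual_bound`). [cite: MoeglinWaldspurger1995, IV.1.9, IV.1.11, IV.3.12 (a)] [cite: Arthur1980TraceFormulaII, §4] -/
theorem meromorphicOrderAt_nonneg_of_family_offDual_on' [CompleteSpace V'] {D₁ : Set ℂ} (hD₁ : IsOpen D₁) (hD₁c : IsPreconnected D₁) (hD₁sub : D₁ ⊆ {z : ℂ | 1 / 2 < z.re ∧ 0 < z.im})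
    {O₁ O₂' : Set ℂ} (hO₁ : IsOpen O₁) (hO₁ne : O₁.Nonempty) (hO₁D : O₁ ⊆ D₁) (hO₂' : IsOpen O₂') (hO₂'ne : O₂'.Nonempty) (hO₂'D : O₂' ⊆ D₁)
    (hsep : ∀ z ∈ O₁, ∀ z' ∈ O₂', 1 < z'.re ∧ z'.re < z.re)
    {T cμ K κ m : ℝ} (hT : 1 ≤ T) (hcμ : 0 < cμ) (hK : 0 < K) (hκ : 0 < κ) (hm : 0 < m) (φ : V) {ψ : ℂ → V'} (hψ : DifferentiableOn ℂ ψ D₁)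
    (F : ℂ → H) (hFd : DifferentiableOn ℂ F D₁)
    (hrel : ∀ z ∈ D₁, ∀ z' ∈ D₁, 1 < z'.re → z'.re < z.re →
      ⟪F z', F z⟫_ℂ = ((cμ : ℝ) : ℂ) * (((K : ℝ) : ℂ) *
        ((((T : ℝ) : ℂ) ^ (z + conj z' - 1) / (z + conj z' - 1)) * (((κ : ℝ) : ℂ) * (((m : ℝ) : ℂ) * ⟪φ, φ⟫_ℂ))
          - (((T : ℝ) : ℂ) ^ (-(z + conj z' - 1)) / (z + conj z' - 1)) * (((κ : ℝ) : ℂ) * (((m : ℝ) : ℂ) * ⟪ψ z', ψ z⟫_ℂ)))))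
    {z₁ : ℂ} (hev : ∀ᶠ z in 𝓝[≠] z₁, z ∈ D₁) :
    MeromorphicAt ψ z₁ ∧ 0 ≤ meromorphicOrderAt ψ z₁ :=
  meromorphicOrderAt_nonneg_of_offDual_bound hev hT (norm_nonneg φ)
    (fun _ hz => norm_le_of_family_offDual_on' hD₁ hD₁c hD₁sub hO₁ hO₁ne hO₁D hO₂' hO₂'ne hO₂'D hsep hT hcμ hK hκ hm φ hψ F hFd hrel hz)
    (hev.mono fun z hz => (hψ z hz).differentiableAt (hD₁.mem_nhds hz))

/-- **THE OFF-DUAL CONTINUED FAMILY HAS AN ANALYTIC CONTINUATION ACROSS EVERY POINT SURROUNDED BY `D₁`** (general boxes): `∃ G, AnalyticAt ℂ G z₁ ∧ G = ψ` on `𝓝[≠] z₁`.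
[cite: MoeglinWaldspurger1995, IV.1.9, IV.1.11] [cite: BernsteinLapid2019, §4 p. 10] -/
theorem exists_analyticAt_extension_of_family_offDual_on' [CompleteSpace V'] {D₁ : Set ℂ} (hD₁ : IsOpen D₁) (hD₁c : IsPreconnected D₁)
    (hD₁sub : D₁ ⊆ {z : ℂ | 1 / 2 < z.re ∧ 0 < z.im})
    {O₁ O₂' : Set ℂ} (hO₁ : IsOpen O₁) (hO₁ne : O₁.Nonempty) (hO₁D : O₁ ⊆ D₁) (hO₂' : IsOpen O₂') (hO₂'ne : O₂'.Nonempty) (hO₂'D : O₂' ⊆ D₁)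
    (hsep : ∀ z ∈ O₁, ∀ z' ∈ O₂', 1 < z'.re ∧ z'.re < z.re)
    {T cμ K κ m : ℝ} (hT : 1 ≤ T) (hcμ : 0 < cμ) (hK : 0 < K) (hκ : 0 < κ) (hm : 0 < m) (φ : V) {ψ : ℂ → V'} (hψ : DifferentiableOn ℂ ψ D₁)
    (F : ℂ → H) (hFd : DifferentiableOn ℂ F D₁)
    (hrel : ∀ z ∈ D₁, ∀ z' ∈ D₁, 1 < z'.re → z'.re < z.re →
      ⟪F z', F z⟫_ℂ = ((cμ : ℝ) : ℂ) * (((K : ℝ) : ℂ) *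
        ((((T : ℝ) : ℂ) ^ (z + conj z' - 1) / (z + conj z' - 1)) * (((κ : ℝ) : ℂ) * (((m : ℝ) : ℂ) * ⟪φ, φ⟫_ℂ))
          - (((T : ℝ) : ℂ) ^ (-(z + conj z' - 1)) / (z + conj z' - 1)) * (((κ : ℝ) : ℂ) * (((m : ℝ) : ℂ) * ⟪ψ z', ψ z⟫_ℂ)))))
    {z₁ : ℂ} (hev : ∀ᶠ z in 𝓝[≠] z₁, z ∈ D₁) :
    ∃ G : ℂ → V', AnalyticAt ℂ G z₁ ∧ G =ᶠ[𝓝[≠] z₁] ψ :=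
  exists_analyticAt_extension_of_offDual_bound hev hT (norm_nonneg φ)
    (fun _ hz => norm_le_of_family_offDual_on' hD₁ hD₁c hD₁sub hO₁ hO₁ne hO₁D hO₂' hO₂'ne hO₂'D hsep hT hcμ hK hκ hm φ hψ F hFd hrel hz)
    (hev.mono fun z hz => (hψ z hz).differentiableAt (hD₁.mem_nhds hz))

/-- **THE OFF-DUAL CONTINUED FAMILY IN NORMAL FORM IS ANALYTIC AT EVERY POINT SURROUNDED BY `D₁`** (general boxes; `MeromorphicNFAt ψ z₁`).
[cite: MoeglinWaldspurger1995, IV.1.9, IV.1.11, IV.3.12 (a)] -/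
theorem analyticAt_of_family_offDual_on' {D₁ : Set ℂ} (hD₁ : IsOpen D₁) (hD₁c : IsPreconnected D₁) (hD₁sub : D₁ ⊆ {z : ℂ | 1 / 2 < z.re ∧ 0 < z.im})
    {O₁ O₂' : Set ℂ} (hO₁ : IsOpen O₁) (hO₁ne : O₁.Nonempty) (hO₁D : O₁ ⊆ D₁) (hO₂' : IsOpen O₂') (hO₂'ne : O₂'.Nonempty) (hO₂'D : O₂' ⊆ D₁)
    (hsep : ∀ z ∈ O₁, ∀ z' ∈ O₂', 1 < z'.re ∧ z'.re < z.re)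
    {T cμ K κ m : ℝ} (hT : 1 ≤ T) (hcμ : 0 < cμ) (hK : 0 < K) (hκ : 0 < κ) (hm : 0 < m) (φ : V) {ψ : ℂ → V'} (hψ : DifferentiableOn ℂ ψ D₁)
    (F : ℂ → H) (hFd : DifferentiableOn ℂ F D₁)
    (hrel : ∀ z ∈ D₁, ∀ z' ∈ D₁, 1 < z'.re → z'.re < z.re →
      ⟪F z', F z⟫_ℂ = ((cμ : ℝ) : ℂ) * (((K : ℝ) : ℂ) *
        ((((T : ℝ) : ℂ) ^ (z + conj z' - 1) / (z + conj z' - 1)) * (((κ : ℝ) : ℂ) * (((m : ℝ) : ℂ) * ⟪φ, φ⟫_ℂ))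
          - (((T : ℝ) : ℂ) ^ (-(z + conj z' - 1)) / (z + conj z' - 1)) * (((κ : ℝ) : ℂ) * (((m : ℝ) : ℂ) * ⟪ψ z', ψ z⟫_ℂ)))))
    {z₁ : ℂ} (hev : ∀ᶠ z in 𝓝[≠] z₁, z ∈ D₁) (hNF : MeromorphicNFAt ψ z₁) : AnalyticAt ℂ ψ z₁ :=
  analyticAt_of_offDual_bound hev hT (norm_nonneg φ)
    (fun _ hz => norm_le_of_family_offDual_on' hD₁ hD₁c hD₁sub hO₁ hO₁ne hO₁D hO₂' hO₂'ne hO₂'D hsep hT hcμ hK hκ hm φ hψ F hFd hrel hz) hNF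

end OffDual

end Summit.HodgeConjecture.HodgeConjecture.Cruxes.H413.K2E1ChiScatteringBoundMaassSelbergOnBoxesU2

end
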